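import Mathlib
import HarnessLib
import Summits.NavierStokesRegularity.NavierStokesRegularity.Theorems.UnthreadedDoorIndicatrixCellCountNearCentreFibres
import Summits.NavierStokesRegularity.NavierStokesRegularity.Theorems.UnthreadedDoorIndicatrixCellCounting

/-!
# Route `UnthreadedDoor`, crux `PoloidalLiouville` (stmt-NavierStokesRegularity-1222), WALL W1 — crux idea «indicatrix-bound», Λ-geo‴:
# uniform near-centre CELL COUNT for jointly analytic unthreaded data (M Lean bridge from F2)

★ `analyticCellCountNearCentre_of : <F2 `BierstoneMilman1988_fibre_components_bounded` body verbatim> → <Λ-geo‴ `AnalyticCellCountNearCentre` body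
verbatim>` — the registered stub `stub_analyticCellCountNearCentre` of `Cruxes/PoloidalLiouville/IndicatrixSketch.lean` v1.7.3 (custodian ns-idea-14),
both Props unfolded (`cellSet`/`sphCrit` are the CellFlux Defs twin's, p692073), so the sketch closes it by the bare term; and
★ `analyticCellCountNearCentre_of_realAnExp` — the same modulo the ONE standing fact `VandendriesMiller1994_realAnExp_isOMinimal` (F2 = p710694).
Assembly of part 1 (`componentsBounded_nearCentre_of`: F2 bounds the components of the regular parts `S_a ∖ sphCrit (T t) x₀ a` uniformly on
`[t₁,t₂] × (0,1)`) with the counting step (`cellSet_finite_ncard_le`: cells ≤ components of the regular part).  Nothing here is an NS statement;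
⟨1222⟩ / W1 / NS regularity OPEN.  `--supports stmt-NavierStokesRegularity-1222 --as helper`.  [folklore]
-/

noncomputable section

-- the summit and its single sub-problem share the name (CONVENTIONS §1)
set_option linter.dupNamespace false

open Set Function Filter Topology

namespace Summit.NavierStokesRegularity.NavierStokesRegularity.Theorems.PoloidalLiouville.Indicatrix

open Summit.NavierStokesRegularity.NavierStokesRegularity.Theorems.PoloidalLiouville.NetFlux (E3)
open Summit.NavierStokesRegularity.NavierStokesRegularity.Theorems.PoloidalLiouville.CellFlux (sphCrit cellSet)
open Literature.Analysis Literature.Analysis.FluidPDE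

/-- ★ **Λ-geo‴ as a bridge from F2**: for `v` jointly analytic on the window slab with the link `curl (v t) = ∇(T t) × (· − x₀)`, the cell counts of the
slices `T t|_{S_a(x₀)}` are finite and uniformly bounded on `[t₁,t₂] × (0,1)` (the bodies of `BierstoneMilman1988_fibre_components_bounded` and
`AnalyticCellCountNearCentre`, verbatim). [folklore] -/
theorem analyticCellCountNearCentre_of
    (hF2 : ∀ (m : ℕ) (E : Type) [NormedAddCommGroup E] [NormedSpace ℝ E] [FiniteDimensional ℝ E]
      (P : Set (Fin m → ℝ)) (U : Set E) (a b : Fin m → ℝ) (H G : (Fin m → ℝ) × E → ℝ),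
      IsOpen P → IsOpen U → Set.Icc a b ⊆ P → AnalyticOnNhd ℝ H (P ×ˢ U) → AnalyticOnNhd ℝ G (P ×ˢ U) →
      IsCompact {q : (Fin m → ℝ) × E | q.1 ∈ Set.Icc a b ∧ q.2 ∈ U ∧ H q = 0} →
        ∃ N : ℕ, ∀ p ∈ Set.Icc a b,
          (connectedComponentIn {x | x ∈ U ∧ H (p, x) = 0 ∧ G (p, x) = 0} '' {x | x ∈ U ∧ H (p, x) = 0 ∧ G (p, x) = 0}).Finite ∧
          (connectedComponentIn {x | x ∈ U ∧ H (p, x) = 0 ∧ G (p, x) = 0} '' {x | x ∈ U ∧ H (p, x) = 0 ∧ G (p, x) = 0}).ncard ≤ N ∧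
          (connectedComponentIn {x | x ∈ U ∧ H (p, x) = 0 ∧ G (p, x) ≠ 0} '' {x | x ∈ U ∧ H (p, x) = 0 ∧ G (p, x) ≠ 0}).Finite ∧
          (connectedComponentIn {x | x ∈ U ∧ H (p, x) = 0 ∧ G (p, x) ≠ 0} '' {x | x ∈ U ∧ H (p, x) = 0 ∧ G (p, x) ≠ 0}).ncard ≤ N) :
    ∀ (v : ℝ → E3 → E3) (x₀ : E3) (T : ℝ → E3 → ℝ) (t₀ t₁ t₂ : ℝ), t₀ < t₁ → t₁ ≤ t₂ → t₂ < 0 →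
      AnalyticOnNhd ℝ (uncurry v) (Ioo t₀ 0 ×ˢ (univ : Set E3)) →
      (∀ t ∈ Ioo t₀ 0, ∀ x, curl (v t) x = cross (gradient (T t) x) (x - x₀)) →
      ∃ N₀ : ℕ, ∀ t ∈ Icc t₁ t₂, ∀ a ∈ Ioo (0 : ℝ) 1, (cellSet (T t) x₀ a).Finite ∧ (cellSet (T t) x₀ a).ncard ≤ N₀ := by
  intro v x₀ T t₀ t₁ t₂ h01 h12 h20 hv hlink
  obtain ⟨N, hN⟩ := componentsBounded_nearCentre_of hF2 v x₀ T t₀ t₁ t₂ h01 h12 h20 hv hlink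
  refine ⟨N, fun t ht a ha => ?_⟩
  obtain ⟨hfin, hle⟩ := hN t ht a ha
  obtain ⟨h1, h2⟩ := cellSet_finite_ncard_le ha.1 hfin
  exact ⟨h1, h2.trans hle⟩

/-- ★ **Λ-geo‴ modulo the one standing fact**: with the o-minimality of `ℝ_an,exp` (`VandendriesMiller1994_realAnExp_isOMinimal`), F2 is the landed
theorem `Literature.Analysis.Calculus.analyticSignSet_fibre_connectedComponents_bounded_of_realAnExp_isOMinimal` (p710694). [folklore] -/
theorem analyticCellCountNearCentre_of_realAnExp
    (hO : Literature.ModelTheory.ExponentialFields.VandendriesMiller1994_realAnExp_isOMinimal) :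
    ∀ (v : ℝ → E3 → E3) (x₀ : E3) (T : ℝ → E3 → ℝ) (t₀ t₁ t₂ : ℝ), t₀ < t₁ → t₁ ≤ t₂ → t₂ < 0 →
      AnalyticOnNhd ℝ (uncurry v) (Ioo t₀ 0 ×ˢ (univ : Set E3)) →
      (∀ t ∈ Ioo t₀ 0, ∀ x, curl (v t) x = cross (gradient (T t) x) (x - x₀)) →
      ∃ N₀ : ℕ, ∀ t ∈ Icc t₁ t₂, ∀ a ∈ Ioo (0 : ℝ) 1, (cellSet (T t) x₀ a).Finite ∧ (cellSet (T t) x₀ a).ncard ≤ N₀ :=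
  analyticCellCountNearCentre_of
    (Literature.Analysis.Calculus.analyticSignSet_fibre_connectedComponents_bounded_of_realAnExp_isOMinimal hO)

end Summit.NavierStokesRegularity.NavierStokesRegularity.Theorems.PoloidalLiouville.Indicatrix

end
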